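import Literature.NumberTheory.LFunctions.ConreyIwaniec2002Prop64DiagonalBlocks
import HarnessLib

/-!
# Conrey–Iwaniec (2002), §6 (6.51): the diagonal of Proposition 6.4 in the large range — PROVED

B. Conrey, H. Iwaniec, *Spacing of zeros of Hecke `L`-functions and the class number problem*,
Acta Arith. 103 (2002) 259–312, §6 p. 16–17 [held text `paper:arxiv-math_0111012` p0016–p0017]:
after Corollary 6.3 ((6.49): `Σ_{X ≤ n ≤ Y} τ²(n,χ)n^{-1} ≪ ℒ(Y) log(Y/X) + (q/X)^{1/2}`) the proof
of Proposition 6.4 bounds the diagonal `G = Σ_n |a(n)λ(n)|²n^{-1}` (6.40) of Corollary 6.2, for a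
cut-off `a` of the class (6.38) with `Y = qT`, by

> `G ≪ ℒ(T) log q + (q/T)^{1/2}` (6.51)

("by (6.42) and (6.49)"; `|λ(n)| ≤ τ(n,χ)` is (6.42)).

PROVED HERE (cell `landau-siegel/ls-inputs`, line `thm61-cm-convolution`, registered stub **S4
`stub_diagonal`** of SKELETON P64, statement VERBATIM): `ConreyIwaniec2002.prop64_diagonal` — one
absolute `c` with, for `q > 4`, `χ` primitive quadratic odd mod `q`, `T ≥ q³` and `a` with
`IsCutoff a T (qT)`: the series `Σ_n τ(n,χ)²|a(n)|²/n` is summable and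
`≤ c (ℒ(T) log q + √q · T^{-9/20})`. The remainder `√q T^{-9/20}` (in place of print's
`(q/T)^{1/2}`) is that of the tree's KERNEL theorem `ConreyIwaniec2002.corollary63_large`
(Corollary 6.3 for `X ≥ q²`), the only arithmetic input; the dyadic bookkeeping (weights from
(6.38), the blocks `[T/2^{j+1}, T/2^j]`, the segment `[T, qT]`, the blocks `[qT2^m, qT2^{m+1}]`,
the trivial range `n < 2q²`, the covering) is `ConreyIwaniec2002Prop64DiagonalBlocks.lean` and the
two pieces below; a uniform bound for the partial sums of the non-negative series gives
summability and the bound, with `c = 11C + 1536`, `C` the constant of `corollary63_large`.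
No lower bound for `L(1,χ)` is used.

«The programme SEARCHES and TYPES; no claim about Landau–Siegel zeros, Theorems 1–2 of
arXiv:2211.02515 or a repaired Margin232 until a kernel theorem says so.»

## References

* [ConreyIwaniec2002] B. Conrey, H. Iwaniec, Acta Arith. 103 (2002) 259–312, arXiv:math/0111012:
  §6 (6.38), (6.40), (6.42), Corollary 6.3 (6.49)–(6.50), (6.51), Proposition 6.4 (6.52).
-/

noncomputable section

open Complex

namespace Literature.NumberTheory.LFunctions

namespace ConreyIwaniec2002

namespace Prop64Diagonal

/-! ### The two remaining pieces: the segment `[T, qT]` and the blocks above `qT` -/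

/-- **The segment `[T, qT]`**: `Σ τ(n,χ)²|a(n)|²/n ≤ C(2ℒ(T) log q + √q·T^{-9/20})` (weight `≤ 1`,
Corollary 6.3 on `[T, qT]`, `ℒ(qT) = ℒ(T) + L(1,χ)² log q ≤ 2ℒ(T)`).
[cite: ConreyIwaniec2002, §6 (6.49), (6.51)] -/
theorem sum_middle_le {q : ℕ} [NeZero q] (χ : DirichletCharacter ℂ q) {T : ℝ} {a : ℝ → ℂ}
    {C : ℝ} (hq : 4 < q) (hT : (q : ℝ) ^ 3 ≤ T) (ha : IsCutoff a T (q * T)) (hC : 0 ≤ C)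
    (hmid : ∑ n ∈ Finset.Icc ⌈T⌉₊ ⌊(q : ℝ) * T⌋₊, ‖divisorSumChar χ n‖ ^ 2 / (n : ℝ) ≤
        C * (calL χ ((q : ℝ) * T) * Real.log q + Real.sqrt q * T ^ (-(9 / 20 : ℝ)))) :
    ∑ n ∈ Finset.Icc ⌈T⌉₊ ⌊(q : ℝ) * T⌋₊, ‖divisorSumChar χ n‖ ^ 2 * ‖a n‖ ^ 2 / (n : ℝ) ≤
      C * (2 * calL χ T * Real.log q + Real.sqrt q * T ^ (-(9 / 20 : ℝ))) := by
  obtain ⟨hq5, _, _, hT125, hlogq1, _⟩ := range_facts hq hT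
  obtain ⟨_, _, hℓ2q⟩ := calL_facts χ hq hT
  have hq0 : (0 : ℝ) < q := by linarith
  have hT0 : 0 < T := by linarith
  have hqT0 : 0 < (q : ℝ) * T := by positivity
  have hw1 : ∀ n ∈ Finset.Icc ⌈T⌉₊ ⌊(q : ℝ) * T⌋₊, ‖a n‖ ^ 2 ≤ 1 := by
    intro n hn
    have hn1 : T ≤ n := Nat.ceil_le.mp (Finset.mem_Icc.mp hn).1
    exact (normSq_le_of_isCutoff ha hT0 hqT0 (lt_of_lt_of_le hT0 hn1)).1
  have hcal : calL χ ((q : ℝ) * T) * Real.log q ≤ 2 * calL χ T * Real.log q := by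
    rw [calL_mul χ hq0 hT0]
    have := mul_le_mul_of_nonneg_right hℓ2q (by linarith : 0 ≤ Real.log q)
    nlinarith
  calc ∑ n ∈ Finset.Icc ⌈T⌉₊ ⌊(q : ℝ) * T⌋₊, ‖divisorSumChar χ n‖ ^ 2 * ‖a n‖ ^ 2 / (n : ℝ)
      ≤ 1 * ∑ n ∈ Finset.Icc ⌈T⌉₊ ⌊(q : ℝ) * T⌋₊, ‖divisorSumChar χ n‖ ^ 2 / (n : ℝ) :=
        sum_weighted_le χ a hw1
    _ ≤ C * (calL χ ((q : ℝ) * T) * Real.log q + Real.sqrt q * T ^ (-(9 / 20 : ℝ))) := by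
        rw [one_mul]; exact hmid
    _ ≤ C * (2 * calL χ T * Real.log q + Real.sqrt q * T ^ (-(9 / 20 : ℝ))) := by gcongr

/-- **The blocks above `qT`**: the block `[qT2^m, qT2^{m+1}]` has
`Σ τ(n,χ)²|a(n)|²/n ≤ 3C(ℒ(T) + √q·T^{-9/20})·128^{-m}` (weight `|a(n)|² ≤ 256^{-m}`, Corollary
6.3 on the block, `ℒ(qT2^{m+1}) log 2 ≤ (m+3)ℒ(T)`, `(m+3)256^{-m} ≤ 3·128^{-m}`).
[cite: ConreyIwaniec2002, §6 (6.49), (6.51)] -/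
theorem sum_topBlock_le {q : ℕ} [NeZero q] (χ : DirichletCharacter ℂ q) {T : ℝ} {a : ℝ → ℂ}
    {C : ℝ} (hq : 4 < q) (hT : (q : ℝ) ^ 3 ≤ T) (ha : IsCutoff a T (q * T)) (hC : 0 ≤ C)
    (hblock : ∀ X : ℝ, (q : ℝ) ^ 2 ≤ X →
      ∑ n ∈ Finset.Icc ⌈X⌉₊ ⌊2 * X⌋₊, ‖divisorSumChar χ n‖ ^ 2 / (n : ℝ) ≤
        C * (calL χ (2 * X) * Real.log 2 + Real.sqrt q * X ^ (-(9 / 20 : ℝ))))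
    (m : ℕ) :
    ∑ n ∈ Finset.Icc ⌈(q : ℝ) * T * 2 ^ m⌉₊ ⌊2 * ((q : ℝ) * T * 2 ^ m)⌋₊,
        ‖divisorSumChar χ n‖ ^ 2 * ‖a n‖ ^ 2 / (n : ℝ) ≤
      3 * C * (calL χ T + Real.sqrt q * T ^ (-(9 / 20 : ℝ))) * (1 / 128 : ℝ) ^ m := by
  obtain ⟨hq5, hq2, _, hT125, hlogq1, _⟩ := range_facts hq hT
  obtain ⟨hℒ0, hℓ2, hℓ2q⟩ := calL_facts χ hq hT
  have hq1 : (1 : ℝ) ≤ q := by linarith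
  have hq0 : (0 : ℝ) < q := by linarith
  have hT0 : 0 < T := by linarith
  have hqT0 : 0 < (q : ℝ) * T := by positivity
  set ℒ : ℝ := calL χ T with hℒ
  set ℓ : ℝ := ‖χ.LFunction 1‖ with hℓ
  set R : ℝ := Real.sqrt q * T ^ (-(9 / 20 : ℝ)) with hR
  set X : ℝ := (q : ℝ) * T * 2 ^ m with hX
  have hR0 : 0 ≤ R := by rw [hR]; positivity
  have hlog2 : Real.log 2 ≤ 1 := by
    have := Real.log_le_sub_one_of_pos (by norm_num : (0 : ℝ) < 2); linarith
  have hX0 : 0 < X := by positivity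
  have hTX : T ≤ X :=
    calc T ≤ (q : ℝ) * T := le_mul_of_one_le_left hT0.le hq1
      _ ≤ (q : ℝ) * T * 2 ^ m := le_mul_of_one_le_right hqT0.le (one_le_pow₀ (by norm_num))
  have hXq : (q : ℝ) ^ 2 ≤ X := hq2.trans hTX
  -- the weight on the block
  have hwU : ∀ n ∈ Finset.Icc ⌈X⌉₊ ⌊2 * X⌋₊, ‖a n‖ ^ 2 ≤ (1 / 256 : ℝ) ^ m := by
    intro n hn
    rw [Finset.mem_Icc] at hn
    have hn1 : X ≤ n := Nat.ceil_le.mp hn.1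
    have hnpos : (0 : ℝ) < n := lt_of_lt_of_le hX0 hn1
    have hqTn : (q : ℝ) * T / n ≤ (1 / 2 : ℝ) ^ m := by
      rw [div_le_iff₀ hnpos]
      calc (q : ℝ) * T = (1 / 2 : ℝ) ^ m * X := by rw [hX, one_div_pow]; field_simp
        _ ≤ (1 / 2 : ℝ) ^ m * n := mul_le_mul_of_nonneg_left hn1 (by positivity)
    calc ‖a n‖ ^ 2 ≤ ((q : ℝ) * T / n) ^ 8 := (normSq_le_of_isCutoff ha hT0 hqT0 hnpos).2.2
      _ ≤ ((1 / 2 : ℝ) ^ m) ^ 8 := pow_le_pow_left₀ (by positivity) hqTn 8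
      _ = (1 / 256 : ℝ) ^ m := half_pow_pow_eight m
  -- `ℒ(2qT2^m) log 2 ≤ (m+3)ℒ(T)`
  have hcal : calL χ (2 * X) * Real.log 2 ≤ ((m : ℝ) + 3) * ℒ := by
    have h2X : 2 * X = (2 * q * 2 ^ m) * T := by rw [hX]; ring
    rw [h2X, calL_mul χ (by positivity) hT0, ← hℒ, ← hℓ]
    have hlog : Real.log (2 * q * 2 ^ m) = Real.log 2 + Real.log q + m * Real.log 2 := by
      rw [Real.log_mul (by positivity) (by positivity), Real.log_mul (by norm_num) hq0.ne',
        Real.log_pow]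
    rw [hlog]
    have hm0 : (0 : ℝ) ≤ m := Nat.cast_nonneg m
    have e1 := mul_le_mul_of_nonneg_left hlog2 (sq_nonneg ℓ)
    have e2 := mul_le_mul_of_nonneg_left hlog2 (mul_nonneg hm0 (sq_nonneg ℓ))
    have e3 := mul_le_mul_of_nonneg_left hℓ2 hm0
    have e4 : 0 ≤ ℒ + ℓ ^ 2 * (Real.log 2 + Real.log q + m * Real.log 2) := by positivity
    calc (ℒ + ℓ ^ 2 * (Real.log 2 + Real.log q + m * Real.log 2)) * Real.log 2
        ≤ (ℒ + ℓ ^ 2 * (Real.log 2 + Real.log q + m * Real.log 2)) * 1 :=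
          mul_le_mul_of_nonneg_left hlog2 e4
      _ ≤ ((m : ℝ) + 3) * ℒ := by linarith
  have hrem : Real.sqrt q * X ^ (-(9 / 20 : ℝ)) ≤ R := by
    rw [hR]
    exact mul_le_mul_of_nonneg_left (Real.rpow_le_rpow_of_nonpos hT0 hTX (by norm_num))
      (Real.sqrt_nonneg _)
  have e5 : (1 / 256 : ℝ) ^ m ≤ 3 * (1 / 128 : ℝ) ^ m :=
    le_trans (pow_le_pow_left₀ (by norm_num) (by norm_num) m)
      (le_mul_of_one_le_left (by positivity) (by norm_num))
  calc ∑ n ∈ Finset.Icc ⌈X⌉₊ ⌊2 * X⌋₊, ‖divisorSumChar χ n‖ ^ 2 * ‖a n‖ ^ 2 / (n : ℝ)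
      ≤ (1 / 256 : ℝ) ^ m * ∑ n ∈ Finset.Icc ⌈X⌉₊ ⌊2 * X⌋₊, ‖divisorSumChar χ n‖ ^ 2 / (n : ℝ) :=
        sum_weighted_le χ a hwU
    _ ≤ (1 / 256 : ℝ) ^ m *
          (C * (calL χ (2 * X) * Real.log 2 + Real.sqrt q * X ^ (-(9 / 20 : ℝ)))) :=
        mul_le_mul_of_nonneg_left (hblock X hXq) (by positivity)
    _ ≤ (1 / 256 : ℝ) ^ m * (C * (((m : ℝ) + 3) * ℒ + R)) := by gcongr
    _ = C * (((m : ℝ) + 3) * (1 / 256 : ℝ) ^ m) * ℒ + C * (1 / 256 : ℝ) ^ m * R := by ring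
    _ ≤ C * (3 * (1 / 128 : ℝ) ^ m) * ℒ + C * (3 * (1 / 128 : ℝ) ^ m) * R :=
        add_le_add
          (mul_le_mul_of_nonneg_right (mul_le_mul_of_nonneg_left (weight_top_le m) hC) hℒ0)
          (mul_le_mul_of_nonneg_right (mul_le_mul_of_nonneg_left e5 hC) hR0)
    _ = 3 * C * (ℒ + R) * (1 / 128 : ℝ) ^ m := by ring

end Prop64Diagonal

open Prop64Diagonal

/-! ### The diagonal (6.51) -/

/-- **CONREY–IWANIEC (2002), (6.51): THE DIAGONAL OF PROPOSITION 6.4 IN THE LARGE RANGE (PROVED;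
registered stub S4 `stub_diagonal` of SKELETON P64, verbatim).** For `a` in the class (6.38) with
`Y = qT`, `T ≥ q³`: `Σ_n τ(n,χ)²|a(n)|²/n ≤ c(ℒ(T) log q + √q·T^{-9/20})` (and the series is
summable) — dyadic summation of the KERNEL Corollary 6.3 in the range `X ≥ q²`
(`ConreyIwaniec2002.corollary63_large`, remainder `√q·X^{-9/20}`) with the weights
`|a(y)|² ≤ (1 + y/qT + T/y)^{-8}`, and the trivial bound `τ(n,χ)² ≤ n²` below `2q²`.
[cite: ConreyIwaniec2002, §6 (6.48)–(6.51), Corollary 6.3 (6.49)] -/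
theorem prop64_diagonal :
    ∃ c : ℝ, 0 < c ∧
      ∀ (q : ℕ) [NeZero q], 4 < q → ∀ χ : DirichletCharacter ℂ q,
        χ.IsPrimitive → χ.IsQuadratic → χ.Odd →
          ∀ (T : ℝ) (a : ℝ → ℂ), (q : ℝ) ^ (3 : ℕ) ≤ T → IsCutoff a T (q * T) →
            Summable (fun n : ℕ ↦ ‖divisorSumChar χ n‖ ^ 2 * ‖a n‖ ^ 2 / (n : ℝ)) ∧
              ∑' n : ℕ, ‖divisorSumChar χ n‖ ^ 2 * ‖a n‖ ^ 2 / (n : ℝ) ≤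
                c * (calL χ T * Real.log q + Real.sqrt q * T ^ (-(9 / 20 : ℝ))) := by
  obtain ⟨C, hC, h63⟩ := corollary63_large
  refine ⟨11 * C + 1536, by positivity, ?_⟩
  intro q _ hq χ hprim hquad hodd T a hT ha
  have hf0 : ∀ n : ℕ, 0 ≤ ‖divisorSumChar χ n‖ ^ 2 * ‖a n‖ ^ 2 / (n : ℝ) := fun n => by
    positivity
  suffices hpart : ∀ N : ℕ,
      ∑ n ∈ Finset.range N, ‖divisorSumChar χ n‖ ^ 2 * ‖a n‖ ^ 2 / (n : ℝ) ≤
        (11 * C + 1536) * (calL χ T * Real.log q + Real.sqrt q * T ^ (-(9 / 20 : ℝ))) from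
    ⟨summable_of_sum_range_le hf0 hpart, Real.tsum_le_of_sum_range_le hf0 hpart⟩
  intro N
  obtain ⟨hq5, hq2, _, hT125, hlogq1, _⟩ := range_facts hq hT
  obtain ⟨hℒ0, _, _⟩ := calL_facts χ hq hT
  have h63' := h63 q hq χ hprim hquad hodd
  set ℒ : ℝ := calL χ T with hℒ
  set R : ℝ := Real.sqrt q * T ^ (-(9 / 20 : ℝ)) with hR
  have hq1 : (1 : ℝ) ≤ q := by linarith
  have hT0 : 0 < T := by linarith
  have hT1 : 1 ≤ T := by linarith
  have hqT1 : 1 ≤ (q : ℝ) * T := one_le_mul_of_one_le_of_one_le hq1 hT1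
  have hq2T : 2 * T ≤ (q : ℝ) * T := by nlinarith
  have hR0 : 0 ≤ R := by rw [hR]; positivity
  -- Corollary 6.3 on a dyadic block `[X, 2X]`, `X ≥ q²`, and on `[T, qT]`
  have hblock : ∀ X : ℝ, (q : ℝ) ^ 2 ≤ X →
      ∑ n ∈ Finset.Icc ⌈X⌉₊ ⌊2 * X⌋₊, ‖divisorSumChar χ n‖ ^ 2 / (n : ℝ) ≤
        C * (calL χ (2 * X) * Real.log 2 + Real.sqrt q * X ^ (-(9 / 20 : ℝ))) := by
    intro X hX
    have hX0 : 0 < X := lt_of_lt_of_le (by positivity) hX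
    have h := h63' X (2 * X) hX le_rfl
    have e : 2 * X / X = 2 := by field_simp
    rw [e] at h
    exact h
  have hmidIn : ∑ n ∈ Finset.Icc ⌈T⌉₊ ⌊(q : ℝ) * T⌋₊, ‖divisorSumChar χ n‖ ^ 2 / (n : ℝ) ≤
      C * (calL χ ((q : ℝ) * T) * Real.log q + Real.sqrt q * T ^ (-(9 / 20 : ℝ))) := by
    have h := h63' T ((q : ℝ) * T) hq2 hq2T
    have e : (q : ℝ) * T / T = q := by field_simp
    rw [e] at h
    exact h
  -- the dyadic parameter: `q² ≤ T/2^J < 2q²`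
  obtain ⟨J, hJ1, hJ2⟩ :=
    exists_nat_pow_near (x := T / (q : ℝ) ^ 2) ((one_le_div (by positivity)).mpr hq2) one_lt_two
  have hXJ : (q : ℝ) ^ 2 ≤ T / 2 ^ J := by
    rw [le_div_iff₀ (by positivity)]
    rw [le_div_iff₀ (by positivity)] at hJ1
    linarith
  have hXJ2 : T / 2 ^ J < 2 * (q : ℝ) ^ 2 := by
    rw [div_lt_iff₀ (by positivity)]
    rw [div_lt_iff₀ (by positivity), pow_succ] at hJ2
    linarith
  -- the four pieces
  have htriv := sum_trivial_le χ hq hT ha hXJ2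
  have hbot : ∀ j ∈ Finset.range J,
      ∑ n ∈ Finset.Icc ⌈T / 2 ^ (j + 1)⌉₊ ⌊2 * (T / 2 ^ (j + 1))⌋₊,
          ‖divisorSumChar χ n‖ ^ 2 * ‖a n‖ ^ 2 / (n : ℝ) ≤ C * (ℒ + 2 * R) * (1 / 128 : ℝ) ^ j :=
    fun j hj => sum_bottomBlock_le χ hq hT ha hC.le hblock hXJ (Finset.mem_range.mp hj)
  have hmid := sum_middle_le χ hq hT ha hC.le hmidIn
  have htop : ∀ m ∈ Finset.range N,
      ∑ n ∈ Finset.Icc ⌈(q : ℝ) * T * 2 ^ m⌉₊ ⌊2 * ((q : ℝ) * T * 2 ^ m)⌋₊,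
          ‖divisorSumChar χ n‖ ^ 2 * ‖a n‖ ^ 2 / (n : ℝ) ≤ 3 * C * (ℒ + R) * (1 / 128 : ℝ) ^ m :=
    fun m _ => sum_topBlock_le χ hq hT ha hC.le hblock m
  -- assembly over the dyadic covering
  have hC1 : C * ℒ ≤ C * ℒ * Real.log q := le_mul_of_one_le_right (mul_nonneg hC.le hℒ0) hlogq1
  have hC2 : 0 ≤ C * ℒ * Real.log q := by positivity
  have hC3 : 0 ≤ ℒ * Real.log q := by positivity
  calc ∑ n ∈ Finset.range N, ‖divisorSumChar χ n‖ ^ 2 * ‖a n‖ ^ 2 / (n : ℝ)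
      ≤ ∑ n ∈ (Finset.Iic ⌊T / 2 ^ J⌋₊ ∪
            (Finset.range J).biUnion
              (fun j => Finset.Icc ⌈T / 2 ^ (j + 1)⌉₊ ⌊2 * (T / 2 ^ (j + 1))⌋₊) ∪
            Finset.Icc ⌈T⌉₊ ⌊(q : ℝ) * T⌋₊ ∪
            (Finset.range N).biUnion
              (fun m => Finset.Icc ⌈(q : ℝ) * T * 2 ^ m⌉₊ ⌊2 * ((q : ℝ) * T * 2 ^ m)⌋₊)),
          ‖divisorSumChar χ n‖ ^ 2 * ‖a n‖ ^ 2 / (n : ℝ) :=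
        Finset.sum_le_sum_of_subset_of_nonneg
          (fun n hn => mem_dyadicCover hT0 hqT1 J N n (Finset.mem_range.mp hn))
          (fun n _ _ => hf0 n)
    _ ≤ ∑ n ∈ Finset.Iic ⌊T / 2 ^ J⌋₊, ‖divisorSumChar χ n‖ ^ 2 * ‖a n‖ ^ 2 / (n : ℝ) +
          ∑ j ∈ Finset.range J, ∑ n ∈ Finset.Icc ⌈T / 2 ^ (j + 1)⌉₊ ⌊2 * (T / 2 ^ (j + 1))⌋₊,
            ‖divisorSumChar χ n‖ ^ 2 * ‖a n‖ ^ 2 / (n : ℝ) +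
          ∑ n ∈ Finset.Icc ⌈T⌉₊ ⌊(q : ℝ) * T⌋₊, ‖divisorSumChar χ n‖ ^ 2 * ‖a n‖ ^ 2 / (n : ℝ) +
          ∑ m ∈ Finset.range N,
            ∑ n ∈ Finset.Icc ⌈(q : ℝ) * T * 2 ^ m⌉₊ ⌊2 * ((q : ℝ) * T * 2 ^ m)⌋₊,
              ‖divisorSumChar χ n‖ ^ 2 * ‖a n‖ ^ 2 / (n : ℝ) := by
        refine (sum_union_le_add hf0).trans ?_
        refine add_le_add ((sum_union_le_add hf0).trans (add_le_add
          ((sum_union_le_add hf0).trans (add_le_add le_rfl (sum_biUnion_le_sum hf0))) le_rfl))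
          (sum_biUnion_le_sum hf0)
    _ ≤ 1536 * R + ∑ j ∈ Finset.range J, C * (ℒ + 2 * R) * (1 / 128 : ℝ) ^ j +
          C * (2 * ℒ * Real.log q + R) +
          ∑ m ∈ Finset.range N, 3 * C * (ℒ + R) * (1 / 128 : ℝ) ^ m := by
        exact add_le_add (add_le_add (add_le_add htriv (Finset.sum_le_sum hbot)) hmid)
          (Finset.sum_le_sum htop)
    _ ≤ 1536 * R + C * (ℒ + 2 * R) * 2 + C * (2 * ℒ * Real.log q + R) +
          3 * C * (ℒ + R) * 2 := by
        rw [← Finset.mul_sum, ← Finset.mul_sum]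
        have e1 := mul_le_mul_of_nonneg_left (geom_sum_le_two J)
          (mul_nonneg hC.le (by positivity : 0 ≤ ℒ + 2 * R))
        have e2 := mul_le_mul_of_nonneg_left (geom_sum_le_two N)
          (mul_nonneg (mul_nonneg (by norm_num : (0 : ℝ) ≤ 3) hC.le) (by positivity : 0 ≤ ℒ + R))
        linarith
    _ ≤ (11 * C + 1536) * (ℒ * Real.log q + R) := by linarith

end ConreyIwaniec2002

end Literature.NumberTheory.LFunctions

end
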